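import Summits.CriticalPhenomena.PercolationContinuityZ3.Theorems.PercNearOneGluingNoHeavyQuantFarSunAvgCentral
import Mathlib.Algebra.BigOperators.Group.Finset.Powerset
import Mathlib.Analysis.Complex.Exponential
import HarnessLib

/-!
# FAR beyond trees: LEMMA 1 of the large-`K` theorem — `Σ_k h_k ≥ 14 ⇒ G_avg ≥ 1` (no other hypothesis)

builds on p205010 (kernel theorem, internal audit signed; external expert review pending)

Support file (`--supports stmt-CriticalPhenomena-4575`), seat `prim-cert-1` (gen 37); memo `prim-cert-1/FROM-prim-cert-1-g37-SURPLUS-FAR.md` §7.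
Assembly of the charging criterion (`HairyCycle.witGavg_ge_one_of_charging`, …WitnessAvgSplit) with weights `ω_k = bo_k` (the flank
efficiency of …AvgCentral) and `Ω₀ = P5 := P(T ≤ 5)`:  every pattern without a witness has `≤ 4` members, the central positions outside it
number `> Σ − 12`, each has `bo_k ≥ p₀³/(Σ + p₀)` (`HairyCycle.flankEff_ge`), and `(Σ − 12)p₀³/(Σ+p₀) ≥ (Σ/5)⁵e^{5−Σ} ≥ P5` for `Σ ≥ 14`
(Chernoff `HairyCycle.pow_mul_sum_hairW_count_le_exp` at `θ = 5/Σ`; the numeric inequality via `e⁹ ≥ 8103` and the Taylor polynomial of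
degree 5); the comparison `bo_k·d_k ≤ P5·a_k` holds because `d_k = (1−h_k)·P(T^{(−k)} has no witness) ≤ (1−h_k)·P5` and `a_k ≥ (1−h_k)·bo_k`.

* `HairyCycle.noWit_erase_le_P5` — `Σ_{Q ∌ k, wit Q = ∅} hairW K h⁰ Q ≤ P5`.
* `HairyCycle.boost_ge_flankEff` — `a_k ≥ (1 − h k)·bo_k`.
* `HairyCycle.largeSigma_numeric` — `(S/5)⁵ e^{5−S} ≤ (S − 12)·0.5938³/(S + 0.5938)` for `S ≥ 14`.
* **`HairyCycle.witGavg_ge_one_of_sum_ge`** — LEMMA 1: `0 < h ≤ 1` on `range K` and `Σ_{k<K} h k ≥ 14` give `witGavg K h 2 ≥ 1`.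
No definitions, no sorries, standard axioms.  Elementary [this work].
-/

noncomputable section

namespace Summit.CriticalPhenomena.PercolationContinuityZ3.Theorems.HairyCycle

open Finset
open scoped Classical

variable {K : ℕ}

/-! ## The pattern bound `P_k ≤ P5` -/

/-- Removing hair `k`'s factor: `hairW K h⁰ Q = hairW K h Q + hairW K h (insert k Q)` for `k ∉ Q`, `k < K`. [this work] -/
theorem hairW_update_zero_eq_add (h : ℕ → ℝ) {k : ℕ} (hk : k < K) {Q : Finset ℕ} (hkQ : k ∉ Q) :
    hairW K (Function.update h k 0) Q = hairW K h Q + hairW K h (insert k Q) := by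
  rw [hairW_eq_mul_erase h hk hkQ, hairW_insert_eq_mul_erase h hk hkQ]; ring

/-- **`P_k ≤ P5`**: the patterns avoiding `k` without a witness (layer `2`), weighted without hair `k`, have mass at most
`P5 = Σ_Q hairW K h Q·𝟙[#Q ≤ 5]`. [this work] -/
theorem noWit_erase_le_P5 {h : ℕ → ℝ} (hh : ∀ i, i < K → 0 ≤ h i ∧ h i ≤ 1) {k : ℕ} (hk : k < K) :
    ∑ Q ∈ ((range K).erase k).powerset, hairW K (Function.update h k 0) Q * (if (wit 2 Q).Nonempty then (0 : ℝ) else 1) ≤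
      ∑ Q ∈ (range K).powerset, hairW K h Q * (if (Q ∩ range K).card ≤ 5 then (1 : ℝ) else 0) := by
  have hkS : k ∉ (range K).erase k := Finset.notMem_erase k _
  have hins : insert k ((range K).erase k) = range K := Finset.insert_erase (Finset.mem_range.2 hk)
  have hpw : (range K).powerset = (insert k ((range K).erase k)).powerset := by rw [hins]
  rw [hpw, Finset.sum_powerset_insert hkS, ← Finset.sum_add_distrib]
  refine Finset.sum_le_sum fun Q hQ => ?_
  rw [Finset.mem_powerset] at hQ
  have hkQ : k ∉ Q := fun hm => hkS (hQ hm)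
  have hQK : Q ⊆ range K := hQ.trans (Finset.erase_subset _ _)
  have h1 := hairW_nonneg hh Q
  have h2 := hairW_nonneg hh (insert k Q)
  by_cases hne : (wit 2 Q).Nonempty
  · rw [if_pos hne, mul_zero]
    exact add_nonneg (mul_nonneg h1 (by split_ifs <;> norm_num)) (mul_nonneg h2 (by split_ifs <;> norm_num))
  · have hc : Q.card ≤ 4 := card_le_of_wit_not_nonempty hne
    have hc1 : (Q ∩ range K).card ≤ 5 := (Finset.card_le_card Finset.inter_subset_left).trans (by omega)
    have hc2 : (insert k Q ∩ range K).card ≤ 5 :=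
      (Finset.card_le_card Finset.inter_subset_left).trans ((Finset.card_insert_le k Q).trans (by omega))
    simp only [if_neg hne, if_pos hc1, if_pos hc2, mul_one]
    rw [hairW_update_zero_eq_add h hk hkQ]

/-! ## The boost of `k` dominates its flank efficiency -/

/-- For `Q ⊆ range K ∖ {k}`: `#Q = #(Q ∩ [0,k)) + #(Q ∩ (k,K))`. [this work] -/
theorem card_eq_left_add_right {k : ℕ} {Q : Finset ℕ} (hQ : Q ⊆ (range K).erase k) :
    Q.card = (Q ∩ range k).card + (Q ∩ (range K).filter (fun i => k < i)).card := by
  rw [← Finset.card_union_of_disjoint]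
  · congr 1
    ext e
    simp only [Finset.mem_union, Finset.mem_inter, Finset.mem_range, Finset.mem_filter]
    constructor
    · intro he
      have := hQ he
      rw [Finset.mem_erase, Finset.mem_range] at this
      rcases lt_or_gt_of_ne this.1 with hlt | hgt
      · exact Or.inl ⟨he, hlt⟩
      · exact Or.inr ⟨he, this.2, hgt⟩
    · rintro (⟨he, _⟩ | ⟨he, _⟩) <;> exact he
  · rw [Finset.disjoint_left]
    intro e he he'
    rw [Finset.mem_inter, Finset.mem_range] at he
    rw [Finset.mem_inter, Finset.mem_filter] at he'
    omega

/-- If a pattern `Q ∌ k` has at least two members on each side of `k`, then `k` is a witness of `insert k Q` (layer `2`). [this work] -/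
theorem mem_wit_insert {k : ℕ} {Q : Finset ℕ} (ha : 2 ≤ (Q ∩ range k).card) (hb : 2 ≤ (Q ∩ (range K).filter (fun i => k < i)).card) :
    k ∈ wit 2 (insert k Q) := by
  refine Finset.mem_filter.2 ⟨Finset.mem_insert_self k Q, ?_, ?_⟩
  · refine ha.trans (Finset.card_le_card fun e he => ?_)
    rw [Finset.mem_inter, Finset.mem_range] at he
    exact Finset.mem_filter.2 ⟨Finset.mem_insert_of_mem he.1, he.2⟩
  · refine hb.trans (Finset.card_le_card fun e he => ?_)
    rw [Finset.mem_inter, Finset.mem_filter] at he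
    exact Finset.mem_filter.2 ⟨Finset.mem_insert_of_mem he.1, he.2.2⟩

/-- **The boost of position `k` dominates `(1 − h k)` times its flank efficiency** (layer `2`, `k < K`, `0 ≤ h ≤ 1`). [this work] -/
theorem boost_ge_flankEff {h : ℕ → ℝ} (hh : ∀ i, i < K → 0 ≤ h i ∧ h i ≤ 1) {k : ℕ} (hk : k < K) :
    (1 - h k) * ∑ Q ∈ (range K).powerset, hairW K (Function.update h k 0) Q *
        (if 2 ≤ (Q ∩ range k).card ∧ 2 ≤ (Q ∩ (range K).filter (fun i => k < i)).card
          then 1 / (((Q ∩ range k).card : ℝ) + (Q ∩ (range K).filter (fun i => k < i)).card + 1) else 0) ≤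
      ∑ Q ∈ ((range K).erase k).powerset, hairW K h Q * witAvgKernel 2 (insert k Q) k := by
  have hkS : k ∉ (range K).erase k := Finset.notMem_erase k _
  have hins : insert k ((range K).erase k) = range K := Finset.insert_erase (Finset.mem_range.2 hk)
  -- patterns containing `k` have no weight under `h⁰`
  have hsplit : ∑ Q ∈ (range K).powerset, hairW K (Function.update h k 0) Q *
        (if 2 ≤ (Q ∩ range k).card ∧ 2 ≤ (Q ∩ (range K).filter (fun i => k < i)).card
          then 1 / (((Q ∩ range k).card : ℝ) + (Q ∩ (range K).filter (fun i => k < i)).card + 1) else 0) =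
      ∑ Q ∈ ((range K).erase k).powerset, hairW K (Function.update h k 0) Q *
        (if 2 ≤ (Q ∩ range k).card ∧ 2 ≤ (Q ∩ (range K).filter (fun i => k < i)).card
          then 1 / (((Q ∩ range k).card : ℝ) + (Q ∩ (range K).filter (fun i => k < i)).card + 1) else 0) := by
    symm
    refine Finset.sum_subset (Finset.powerset_mono.2 (Finset.erase_subset k (range K))) fun Q hQ hQ' => ?_
    rw [Finset.mem_powerset] at hQ hQ'
    have hkQ : k ∈ Q := by
      by_contra hkQ
      exact hQ' fun e he => Finset.mem_erase.2 ⟨fun hek => hkQ (hek ▸ he), hQ he⟩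
    rw [hairW_eq_zero_of_mem hk hkQ (Function.update_self k (0 : ℝ) h), zero_mul]
  rw [hsplit, Finset.mul_sum]
  refine Finset.sum_le_sum fun Q hQ => ?_
  rw [Finset.mem_powerset] at hQ
  have hkQ : k ∉ Q := fun hm => hkS (hQ hm)
  rw [hairW_eq_mul_erase h hk hkQ]
  have hw0 : 0 ≤ hairW K (Function.update h k 0) Q :=
    hairW_nonneg (fun i hi => by
      by_cases hik : i = k
      · rw [hik, Function.update_self]; norm_num
      · rw [Function.update_of_ne hik]; exact hh i hi) Q
  have hu : 0 ≤ 1 - h k := by linarith [(hh k hk).2]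
  have e : (1 - h k) * (hairW K (Function.update h k 0) Q *
      (if 2 ≤ (Q ∩ range k).card ∧ 2 ≤ (Q ∩ (range K).filter (fun i => k < i)).card
        then 1 / (((Q ∩ range k).card : ℝ) + (Q ∩ (range K).filter (fun i => k < i)).card + 1) else 0)) =
      (1 - h k) * hairW K (Function.update h k 0) Q *
      (if 2 ≤ (Q ∩ range k).card ∧ 2 ≤ (Q ∩ (range K).filter (fun i => k < i)).card
        then 1 / (((Q ∩ range k).card : ℝ) + (Q ∩ (range K).filter (fun i => k < i)).card + 1) else 0) := by ring
  rw [e]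
  refine mul_le_mul_of_nonneg_left ?_ (mul_nonneg hu hw0)
  split_ifs with hab
  · have hmem := mem_wit_insert (K := K) hab.1 hab.2
    unfold witAvgKernel
    rw [if_pos hmem]
    have hcard : ((wit 2 (insert k Q)).card : ℝ) ≤ ((Q ∩ range k).card : ℝ) + (Q ∩ (range K).filter (fun i => k < i)).card + 1 := by
      have h1 : (wit 2 (insert k Q)).card ≤ (insert k Q).card := Finset.card_le_card fun d hd => mem_of_mem_wit hd
      have h2 : (insert k Q).card = Q.card + 1 := Finset.card_insert_of_notMem hkQ
      rw [card_eq_left_add_right hQ] at h2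
      exact_mod_cast (h1.trans h2.le)
    have hpos : (0 : ℝ) < (wit 2 (insert k Q)).card := by exact_mod_cast Finset.card_pos.2 ⟨k, hmem⟩
    exact one_div_le_one_div_of_le hpos hcard
  · unfold witAvgKernel
    split_ifs
    · exact div_nonneg zero_le_one (Nat.cast_nonneg _)
    · exact le_rfl

/-! ## The numeric inequality -/

/-- `e⁹ ≥ 8103`. [folklore] -/
theorem exp_nine_ge : (8103 : ℝ) ≤ Real.exp 9 := by
  have h1 := Real.exp_one_gt_d9
  have h2 : Real.exp 9 = Real.exp 1 ^ 9 := by rw [← Real.exp_nat_mul]; norm_num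
  rw [h2]
  have h3 : (2.7182818283 : ℝ) ^ 9 ≤ Real.exp 1 ^ 9 := pow_le_pow_left₀ (by norm_num) h1.le 9
  have h4 : (8103 : ℝ) ≤ (2.7182818283 : ℝ) ^ 9 := by norm_num
  linarith

/-- **Numeric core of LEMMA 1**: for `S ≥ 14`, `(S/5)⁵·e^{5−S} ≤ (S − 12)·0.5938³/(S + 0.5938)`. [this work] -/
theorem largeSigma_numeric {S : ℝ} (hS : 14 ≤ S) :
    (S / 5) ^ 5 * Real.exp (5 - S) ≤ (S - 12) * (0.5938 : ℝ) ^ 3 / (S + 0.5938) := by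
  set x := S - 14 with hx
  have hx0 : 0 ≤ x := by linarith
  have hE : (8103 : ℝ) * (1 + x + x ^ 2 / 2 + x ^ 3 / 6 + x ^ 4 / 24 + x ^ 5 / 120) ≤ Real.exp (S - 5) := by
    have e1 : Real.exp (S - 5) = Real.exp 9 * Real.exp x := by rw [← Real.exp_add]; congr 1; rw [hx]; ring
    rw [e1]
    have hT := Real.sum_le_exp_of_nonneg hx0 6
    have hT' : 1 + x + x ^ 2 / 2 + x ^ 3 / 6 + x ^ 4 / 24 + x ^ 5 / 120 ≤ Real.exp x := by
      have e2 : ∑ i ∈ range 6, x ^ i / (Nat.factorial i : ℝ) = 1 + x + x ^ 2 / 2 + x ^ 3 / 6 + x ^ 4 / 24 + x ^ 5 / 120 := by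
        simp [Finset.sum_range_succ, Nat.factorial]
      linarith [e2 ▸ hT]
    have hTpos : 0 ≤ 1 + x + x ^ 2 / 2 + x ^ 3 / 6 + x ^ 4 / 24 + x ^ 5 / 120 := by positivity
    exact mul_le_mul exp_nine_ge hT' hTpos (Real.exp_pos 9).le
  have hpos : 0 < Real.exp (S - 5) := Real.exp_pos _
  have hden : 0 < S + 0.5938 := by linarith
  rw [show (5 : ℝ) - S = -(S - 5) by ring, Real.exp_neg, ← div_eq_mul_inv, div_le_div_iff₀ hpos hden]
  -- `(S/5)^5 (S + p0) ≤ (S − 12) p0³ exp(S−5)`; use the Taylor lower bound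
  have hS' : S = 14 + x := by rw [hx]; ring
  have key : (S / 5) ^ 5 * (S + 0.5938) ≤ (S - 12) * (0.5938 : ℝ) ^ 3 * (8103 * (1 + x + x ^ 2 / 2 + x ^ 3 / 6 + x ^ 4 / 24 + x ^ 5 / 120)) := by
    rw [hS']
    nlinarith [hx0, pow_nonneg hx0 2, pow_nonneg hx0 3, pow_nonneg hx0 4, pow_nonneg hx0 5, pow_nonneg hx0 6, pow_nonneg hx0 7]
  have h12 : 0 ≤ (S - 12) * (0.5938 : ℝ) ^ 3 := by nlinarith
  calc (S / 5) ^ 5 * (S + 0.5938) ≤ (S - 12) * (0.5938 : ℝ) ^ 3 * (8103 * (1 + x + x ^ 2 / 2 + x ^ 3 / 6 + x ^ 4 / 24 + x ^ 5 / 120)) := key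
    _ ≤ (S - 12) * (0.5938 : ℝ) ^ 3 * Real.exp (S - 5) := mul_le_mul_of_nonneg_left hE h12

/-! ## LEMMA 1 -/

/-- **LEMMA 1 (large hair mass).**  If `0 < h k ≤ 1` for `k < K` and `Σ_{k<K} h k ≥ 14`, then the averaged witness weight at layer `2`
satisfies `witGavg K h 2 ≥ 1` — for every `K`, with no further hypothesis. [this work] -/
theorem witGavg_ge_one_of_sum_ge {h : ℕ → ℝ} (hh : ∀ k, k < K → 0 < h k ∧ h k ≤ 1) (hS : 14 ≤ ∑ k ∈ range K, h k) :
    1 ≤ witGavg K h 2 := by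
  have hh' : ∀ k, k < K → 0 ≤ h k ∧ h k ≤ 1 := fun k hk => ⟨(hh k hk).1.le, (hh k hk).2⟩
  set S := ∑ k ∈ range K, h k with hSdef
  -- flank efficiencies and `P5`
  set bo : ℕ → ℝ := fun k => ∑ Q ∈ (range K).powerset, hairW K (Function.update h k 0) Q *
      (if 2 ≤ (Q ∩ range k).card ∧ 2 ≤ (Q ∩ (range K).filter (fun i => k < i)).card
        then 1 / (((Q ∩ range k).card : ℝ) + (Q ∩ (range K).filter (fun i => k < i)).card + 1) else 0) with hbodef
  set P5 := ∑ Q ∈ (range K).powerset, hairW K h Q * (if (Q ∩ range K).card ≤ 5 then (1 : ℝ) else 0) with hP5def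
  have hbo0 : ∀ k, 0 ≤ bo k := by
    intro k
    by_cases hk : k < K
    · exact Finset.sum_nonneg fun Q _ => mul_nonneg (hairW_nonneg (fun i hi => by
        by_cases hik : i = k
        · rw [hik, Function.update_self]; norm_num
        · rw [Function.update_of_ne hik]; exact hh' i hi) Q) (by split_ifs <;> positivity)
    · exact Finset.sum_nonneg fun Q _ => mul_nonneg (hairW_nonneg (fun i hi => by
        rw [Function.update_of_ne (show i ≠ k by omega)]; exact hh' i hi) Q) (by split_ifs <;> positivity)
  -- `P5 ≤ (S/5)^5 e^{5−S}` (Chernoff at `θ = 5/S`)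
  have hS5 : (0 : ℝ) < S := by linarith
  have hP5 : P5 ≤ (S / 5) ^ 5 * Real.exp (5 - S) := by
    have hθ0 : (0 : ℝ) < 5 / S := by positivity
    have hθ1 : 5 / S ≤ 1 := by rw [div_le_one hS5]; linarith
    have hc := pow_mul_sum_hairW_count_le_exp hh' (range K) 5 hθ0 hθ1
    have hfilt : ∑ k ∈ (range K).filter (fun k => k ∈ range K), h k = S := by
      rw [hSdef]; congr 1; ext k; simp
    rw [hfilt] at hc
    have e1 : -(1 - 5 / S) * S = 5 - S := by field_simp; ring
    rw [e1] at hc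
    have hpow : (0 : ℝ) < (5 / S) ^ 5 := pow_pos hθ0 5
    rw [← hP5def] at hc
    calc P5 = ((5 / S) ^ 5 * P5) / (5 / S) ^ 5 := by field_simp
      _ ≤ Real.exp (5 - S) / (5 / S) ^ 5 := div_le_div_of_nonneg_right hc hpow.le
      _ = (S / 5) ^ 5 * Real.exp (5 - S) := by
          rw [div_pow, div_pow, div_div_eq_mul_div]
          field_simp
  -- central positions
  set Cen := (range K).filter (fun k => 3 ≤ ∑ i ∈ range k, h i ∧ 3 ≤ ∑ i ∈ (range K).filter (fun i => k < i), h i) with hCendef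
  have hCen := card_central_gt hh'
  rw [← hSdef, ← hCendef] at hCen
  have hflank : ∀ k ∈ Cen, (0.5938 : ℝ) ^ 3 ≤ bo k * (S + 0.5938) := by
    intro k hk
    rw [hCendef, Finset.mem_filter, Finset.mem_range] at hk
    exact flankEff_ge hh' hk.1 hk.2.1 hk.2.2
  -- the case `P5 = 0`: no deficit at all
  have hP50 : 0 ≤ P5 := Finset.sum_nonneg fun Q _ => mul_nonneg (hairW_nonneg hh' Q) (by split_ifs <;> norm_num)
  rcases eq_or_lt_of_le hP50 with hz | hP5pos
  · -- mass = 1, boost ≥ 0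
    rw [witGavg_eq_mass_add_boost (fun k hk => (hh k hk).1) 2]
    have hmass : ∑ Q ∈ (range K).powerset, hairW K h Q * (if (wit 2 Q).Nonempty then (1 : ℝ) else 0) = 1 := by
      have hdef : ∑ Q ∈ (range K).powerset, hairW K h Q * (if (wit 2 Q).Nonempty then (0 : ℝ) else 1) ≤ P5 := by
        refine Finset.sum_le_sum fun Q hQ => mul_le_mul_of_nonneg_left ?_ (hairW_nonneg hh' Q)
        rw [Finset.mem_powerset] at hQ
        split_ifs with h1 h2
        · norm_num
        · norm_num
        · norm_num
        · exfalso
          have := (Finset.card_le_card (Finset.inter_subset_left (s₁ := Q) (s₂ := range K))).trans (card_le_of_wit_not_nonempty h1)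
          omega
      have hdef0 : 0 ≤ ∑ Q ∈ (range K).powerset, hairW K h Q * (if (wit 2 Q).Nonempty then (0 : ℝ) else 1) :=
        Finset.sum_nonneg fun Q _ => mul_nonneg (hairW_nonneg hh' Q) (by split_ifs <;> norm_num)
      have htot : ∑ Q ∈ (range K).powerset, hairW K h Q * (if (wit 2 Q).Nonempty then (1 : ℝ) else 0) +
          ∑ Q ∈ (range K).powerset, hairW K h Q * (if (wit 2 Q).Nonempty then (0 : ℝ) else 1) = 1 := by
        rw [← Finset.sum_add_distrib]
        calc ∑ Q ∈ (range K).powerset, (hairW K h Q * (if (wit 2 Q).Nonempty then (1 : ℝ) else 0) +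
                hairW K h Q * (if (wit 2 Q).Nonempty then (0 : ℝ) else 1))
            = ∑ Q ∈ (range K).powerset, hairW K h Q := Finset.sum_congr rfl fun Q _ => by split_ifs <;> ring
          _ = 1 := sum_hairW_eq_one h
      linarith
    have hboost : 0 ≤ ∑ k ∈ range K, ∑ Q ∈ ((range K).erase k).powerset, hairW K h Q * witAvgKernel 2 (insert k Q) k :=
      Finset.sum_nonneg fun k _ => Finset.sum_nonneg fun Q _ => mul_nonneg (hairW_nonneg hh' Q) (by
        unfold witAvgKernel; split_ifs
        · exact div_nonneg zero_le_one (Nat.cast_nonneg _)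
        · exact le_rfl)
    linarith
  -- the charging criterion with `ω = bo`, `Ω₀ = P5`
  refine witGavg_ge_one_of_charging hh 2 bo hP5pos (fun H hH hne => ?_) (fun k hk => ?_)
  · -- cover: `P5 ≤ Σ_{k ∉ H} bo_k`
    have hHc : H.card ≤ 4 := card_le_of_wit_not_nonempty hne
    have hsub : Cen \ H ⊆ range K \ H := Finset.sdiff_subset_sdiff (Finset.filter_subset _ _) (subset_refl _)
    have h1 : ∑ k ∈ Cen \ H, bo k ≤ ∑ k ∈ range K \ H, bo k :=
      Finset.sum_le_sum_of_subset_of_nonneg hsub fun k _ _ => hbo0 k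
    have hcardCH : ((Cen.card : ℝ) - 4) ≤ ((Cen \ H).card : ℝ) := by
      have := Finset.le_card_sdiff H Cen
      have h4 : (H.card : ℝ) ≤ 4 := by exact_mod_cast hHc
      have : ((Cen.card : ℝ) - H.card) ≤ ((Cen \ H).card : ℝ) := by
        have h' : Cen.card - H.card ≤ (Cen \ H).card := Finset.le_card_sdiff H Cen
        have : (Cen.card : ℝ) - (H.card : ℝ) ≤ ((Cen.card - H.card : ℕ) : ℝ) := by
          rcases le_or_gt H.card Cen.card with hle | hgt
          · rw [Nat.cast_sub hle]
          · rw [Nat.sub_eq_zero_of_le hgt.le]; push_cast; linarith [(Nat.cast_lt (α := ℝ)).2 hgt]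
        exact this.trans (by exact_mod_cast h')
      linarith
    -- `Σ_{Cen ∖ H} bo ≥ #(Cen ∖ H) · p0³/(S + p0)`
    have hden : 0 < S + 0.5938 := by linarith
    have h2 : ((Cen \ H).card : ℝ) * ((0.5938 : ℝ) ^ 3 / (S + 0.5938)) ≤ ∑ k ∈ Cen \ H, bo k := by
      have := Finset.card_nsmul_le_sum (Cen \ H) bo ((0.5938 : ℝ) ^ 3 / (S + 0.5938)) fun k hk => by
        rw [div_le_iff₀ hden]
        exact hflank k (Finset.mem_sdiff.1 hk).1
      rwa [nsmul_eq_mul] at this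
    have h3 : (S - 12) * ((0.5938 : ℝ) ^ 3 / (S + 0.5938)) ≤ ((Cen \ H).card : ℝ) * ((0.5938 : ℝ) ^ 3 / (S + 0.5938)) :=
      mul_le_mul_of_nonneg_right (by linarith) (by positivity)
    have hnum := largeSigma_numeric hS
    have e : (S - 12) * (0.5938 : ℝ) ^ 3 / (S + 0.5938) = (S - 12) * ((0.5938 : ℝ) ^ 3 / (S + 0.5938)) := by ring
    linarith
  · -- comparison: `bo_k · d_k ≤ P5 · a_k`
    have hd : ∑ Q ∈ ((range K).erase k).powerset, hairW K h Q * (if (wit 2 Q).Nonempty then (0 : ℝ) else 1) =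
        (1 - h k) * ∑ Q ∈ ((range K).erase k).powerset, hairW K (Function.update h k 0) Q * (if (wit 2 Q).Nonempty then (0 : ℝ) else 1) := by
      rw [Finset.mul_sum]
      refine Finset.sum_congr rfl fun Q hQ => ?_
      rw [Finset.mem_powerset] at hQ
      rw [hairW_eq_mul_erase h hk (fun hm => Finset.notMem_erase k _ (hQ hm))]
      ring
    have hPk := noWit_erase_le_P5 hh' hk
    rw [← hP5def] at hPk
    have ha := boost_ge_flankEff hh' hk
    have hu : 0 ≤ 1 - h k := by linarith [(hh k hk).2]
    have hPk0 : 0 ≤ ∑ Q ∈ ((range K).erase k).powerset, hairW K (Function.update h k 0) Q * (if (wit 2 Q).Nonempty then (0 : ℝ) else 1) :=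
      Finset.sum_nonneg fun Q _ => mul_nonneg (hairW_nonneg (fun i hi => by
        by_cases hik : i = k
        · rw [hik, Function.update_self]; norm_num
        · rw [Function.update_of_ne hik]; exact hh' i hi) Q) (by split_ifs <;> norm_num)
    rw [hd]
    calc bo k * ((1 - h k) * ∑ Q ∈ ((range K).erase k).powerset,
          hairW K (Function.update h k 0) Q * (if (wit 2 Q).Nonempty then (0 : ℝ) else 1))
        ≤ bo k * ((1 - h k) * P5) := mul_le_mul_of_nonneg_left (mul_le_mul_of_nonneg_left hPk hu) (hbo0 k)
      _ = P5 * ((1 - h k) * bo k) := by ring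
      _ ≤ P5 * ∑ Q ∈ ((range K).erase k).powerset, hairW K h Q * witAvgKernel 2 (insert k Q) k :=
          mul_le_mul_of_nonneg_left ha hP5pos.le

end Summit.CriticalPhenomena.PercolationContinuityZ3.Theorems.HairyCycle

end
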